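import Literature.AlgebraicGeometry.Resolution.SecantColonAnnihilatorExistence
import Literature.AlgebraicGeometry.Resolution.ColonSecantDSequence
import Mathlib.RingTheory.Finiteness.Basic
import HarnessLib

/-!
# Colon-secant systems of parameters over quotients of regular local rings

Topic: `Literature/AlgebraicGeometry/Resolution` (the form in which the existence of CM-secant /
`p`-standard systems of parameters is consumed by [Kawasaki2000, Thm. 4.1] /
[Cesnavicius2021, Thm. 3.13]: a finite module over an arbitrary Noetherian local ring `R`; here
`R` is a quotient of a regular local ring `S` — e.g. every local ring of a scheme locally of
finite type over a field or over `ℤ`, and every complete local ring (Cohen)).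

For a surjection `S ↠ R` of local rings and an `R`-module `M` (an `S`-module by restriction):

* `supportDim_restrictScalars_of_surjective` — `dim_S Supp M = dim_R Supp M`;
* `isSecantSequence_map_iff` — `r₁,…,r_s ∈ S` is secant for `M` over `S` iff its image is secant
  for `M` over `R`;
* `map_secantColonAnnihilator_le` — the image of `𝔯_S(M)` lies in `𝔯_R(M)`;
* `IsColonSecantSequence.map_of_surjective` — images of colon-secant sequences are colon-secant;
* `exists_isColonSecantSequence_of_surjective` — **every finite module of dimension `d` over a
  local ring that is a quotient of a regular local ring has a colon-secant sequence of length `d`**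
  (from `exists_isColonSecantSequence_length_eq` over `S`).

[cite: Cesnavicius2021, Def. 3.1 (ii); Kawasaki2000, Def. 2.6; Schenzel1982, Kor. 2.4.3]
-/

noncomputable section

open IsLocalRing Ideal Module

universe u v

namespace Literature.AlgebraicGeometry.Resolution

section Transfer

variable {S R : Type u} [CommRing S] [CommRing R] [Algebra S R]
variable {M : Type v} [AddCommGroup M] [Module R M] [Module S M] [IsScalarTower S R M]

/-- `(x)M` over `S` is `(x̄)M` over `R` (same subgroup of `M`), for `S → R` surjective. [folklore] -/
theorem restrictScalars_ofList_map_smul_top (hφ : Function.Surjective (algebraMap S R))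
    (xs : List S) :
    (ofList (xs.map (algebraMap S R)) • ⊤ : Submodule R M).restrictScalars S =
      (ofList xs • ⊤ : Submodule S M) := by
  have hmap : (ofList (xs.map (algebraMap S R)) : Ideal R) = (ofList xs).map (algebraMap S R) := by
    rw [Ideal.ofList, Ideal.ofList, Ideal.map_span]
    congr 1
    ext a
    simp only [Set.mem_setOf_eq, Set.mem_image, List.mem_map]
  refine le_antisymm ?_ ?_
  · intro m hm
    rw [Submodule.restrictScalars_mem] at hm
    refine Submodule.smul_induction_on hm (fun a ha n _ => ?_) (fun x y hx hy => ?_)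
    · rw [hmap, Ideal.mem_map_iff_of_surjective _ hφ] at ha
      obtain ⟨s, hs, rfl⟩ := ha
      rw [algebraMap_smul]
      exact Submodule.smul_mem_smul hs Submodule.mem_top
    · exact Submodule.add_mem _ hx hy
  · refine Submodule.smul_le.mpr fun s hs n _ => ?_
    rw [Submodule.restrictScalars_mem, ← algebraMap_smul R s n]
    exact Submodule.smul_mem_smul (hmap ▸ Ideal.mem_map_of_mem _ hs) Submodule.mem_top

variable (R) in
/-- `Ann_S M` is the preimage of `Ann_R M`. [folklore] -/
theorem annihilator_eq_comap_annihilator :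
    Module.annihilator S M = (Module.annihilator R M).comap (algebraMap S R) := by
  ext s
  simp only [Module.mem_annihilator, Ideal.mem_comap, algebraMap_smul]

/-- **`dim_S Supp M = dim_R Supp M`** for an `R`-module `M` and `S ↠ R` surjective (both are the
dimension of `S/Ann_S M ≅ R/Ann_R M`). [folklore] -/
theorem supportDim_restrictScalars_of_surjective (hφ : Function.Surjective (algebraMap S R))
    [Module.Finite R M] : Module.supportDim S M = Module.supportDim R M := by
  haveI : Module.Finite S R := Module.Finite.of_surjective (Algebra.linearMap S R) hφ
  haveI : Module.Finite S M := Module.Finite.trans R M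
  rw [Module.supportDim_eq_ringKrullDim_quotient_annihilator,
    Module.supportDim_eq_ringKrullDim_quotient_annihilator, annihilator_eq_comap_annihilator R]
  -- `S / φ⁻¹(J) ≅ R / J`
  set J := Module.annihilator R M
  have hsurj : Function.Surjective ((Ideal.Quotient.mk J).comp (algebraMap S R)) :=
    Ideal.Quotient.mk_surjective.comp hφ
  have hker : RingHom.ker ((Ideal.Quotient.mk J).comp (algebraMap S R)) = J.comap (algebraMap S R) := by
    rw [← RingHom.comap_ker, Ideal.mk_ker]
  exact ringKrullDim_eq_of_ringEquiv
    ((Ideal.quotEquivOfEq hker.symm).trans (RingHom.quotientKerEquivOfSurjective hsurj))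

/-- The quotients `M/(x)M` over `S` and `M/(x̄)M` over `R` are the same `S`-module. [folklore] -/
def quotOfListMapEquiv (hφ : Function.Surjective (algebraMap S R)) (xs : List S) :
    (M ⧸ (ofList xs • ⊤ : Submodule S M)) ≃ₗ[S]
      M ⧸ (ofList (xs.map (algebraMap S R)) • ⊤ : Submodule R M) :=
  (Submodule.quotEquivOfEq _ _ (restrictScalars_ofList_map_smul_top hφ xs).symm).trans
    (Submodule.Quotient.restrictScalarsEquiv S _)

/-- **Secant over `S` iff secant over `R`** for `S ↠ R` and an `R`-module `M`. [folklore] -/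
theorem isSecantSequence_map_iff (hφ : Function.Surjective (algebraMap S R)) [Module.Finite R M]
    (xs : List S) : IsSecantSequence M (xs.map (algebraMap S R)) ↔ IsSecantSequence M xs := by
  have key : ∀ n : ℕ,
      Module.supportDim R
          (M ⧸ (ofList ((xs.map (algebraMap S R)).take n) • ⊤ : Submodule R M)) =
        Module.supportDim S (M ⧸ (ofList (xs.take n) • ⊤ : Submodule S M)) := fun n => by
    rw [← supportDim_restrictScalars_of_surjective (S := S) hφ]
    have e : (M ⧸ (ofList ((xs.take n).map (algebraMap S R)) • ⊤ : Submodule R M)) ≃ₗ[S]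
        M ⧸ (ofList ((xs.map (algebraMap S R)).take n) • ⊤ : Submodule R M) :=
      (Submodule.quotEquivOfEq _ _ (by rw [List.map_take])).restrictScalars S
    exact (Module.supportDim_eq_of_equiv ((quotOfListMapEquiv hφ (xs.take n)).trans e)).symm
  unfold IsSecantSequence
  simp only [List.length_map, key]

/-- Membership transfer for the submodules `(x)M`. [folklore] -/
theorem mem_ofList_map_smul_top_iff (hφ : Function.Surjective (algebraMap S R)) (xs : List S)
    (m : M) : m ∈ (ofList (xs.map (algebraMap S R)) • ⊤ : Submodule R M) ↔
      m ∈ (ofList xs • ⊤ : Submodule S M) := by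
  rw [← restrictScalars_ofList_map_smul_top hφ xs, Submodule.restrictScalars_mem]

variable [IsLocalRing S] [IsLocalRing R]

/-- The preimage of `𝔪_R` under a surjection of local rings is `𝔪_S`. [folklore] -/
theorem mem_maximalIdeal_iff_of_surjective (hφ : Function.Surjective (algebraMap S R)) (s : S) :
    algebraMap S R s ∈ maximalIdeal R ↔ s ∈ maximalIdeal S := by
  have hmap : (maximalIdeal S).map (algebraMap S R) ≤ maximalIdeal R := by
    rcases Ideal.map_eq_top_or_isMaximal_of_surjective _ hφ (maximalIdeal.isMaximal S) with h | h
    · exfalso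
      have hcm := Ideal.comap_map_of_surjective _ hφ (maximalIdeal S)
      rw [h, Ideal.comap_top] at hcm
      refine (maximalIdeal.isMaximal S).ne_top (top_le_iff.mp (hcm.le.trans (sup_le le_rfl ?_)))
      exact IsLocalRing.le_maximalIdeal (RingHom.ker_ne_top (algebraMap S R))
    · exact (IsLocalRing.eq_maximalIdeal h).le
  constructor
  · intro h
    by_contra hs
    rw [IsLocalRing.mem_maximalIdeal, mem_nonunits_iff, not_not] at hs
    exact (IsLocalRing.mem_maximalIdeal _ |>.mp h) (hs.map (algebraMap S R))
  · exact fun hs => hmap (Ideal.mem_map_of_mem _ hs)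

/-- **The image of `𝔯_S(M)` lies in `𝔯_R(M)`** (`S ↠ R` local rings, `M` an `R`-module): secant
sequences over `R` lift to secant sequences over `S` with the same colon modules. [folklore] -/
theorem map_secantColonAnnihilator_le (hφ : Function.Surjective (algebraMap S R))
    [Module.Finite R M] :
    (secantColonAnnihilator S M).map (algebraMap S R) ≤ secantColonAnnihilator R M := by
  refine (Ideal.map_le_iff_le_comap).mpr fun c hc => ?_
  rw [Ideal.mem_comap, mem_secantColonAnnihilator_iff]
  intro zs hzs hzmem i hi m hm
  obtain ⟨ws, rfl⟩ := hφ.list_map zs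
  have hws : IsSecantSequence M ws := (isSecantSequence_map_iff hφ ws).mp hzs
  have hwmem : ∀ w ∈ ws, w ∈ maximalIdeal S := fun w hw =>
    (mem_maximalIdeal_iff_of_surjective hφ w).mp (hzmem _ (List.mem_map_of_mem hw))
  have hi' : i < ws.length := by simpa using hi
  rw [List.getElem_map, algebraMap_smul, ← List.map_take, mem_ofList_map_smul_top_iff hφ] at hm
  have := hc hws hwmem hi' hm
  rw [← List.map_take, mem_ofList_map_smul_top_iff hφ, algebraMap_smul]
  exact this

/-- **Images of colon-secant sequences are colon-secant** along a surjection `S ↠ R` of local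
rings. [folklore] -/
theorem IsColonSecantSequence.map_of_surjective (hφ : Function.Surjective (algebraMap S R))
    [Module.Finite R M] {xs : List S} (h : IsColonSecantSequence M xs) :
    IsColonSecantSequence M (xs.map (algebraMap S R)) := by
  refine ⟨(isSecantSequence_map_iff hφ xs).mpr h.1,
    fun r hr => ?_, fun i hi => ?_⟩
  · obtain ⟨x, hx, rfl⟩ := List.mem_map.mp hr
    exact (mem_maximalIdeal_iff_of_surjective hφ x).mpr (h.2.1 x hx)
  · have hi' : i < xs.length := by simpa using hi
    have h1 := h.2.2 i hi'
    rw [List.getElem_map, ← List.map_take]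
    -- transport `𝔯_S` along `M/(x)M ≅ M/(x̄)M`, then push to `𝔯_R`
    rw [secantColonAnnihilator_congr (quotOfListMapEquiv hφ (xs.take i))] at h1
    exact map_secantColonAnnihilator_le hφ (Ideal.mem_map_of_mem _ h1)

end Transfer

/-! ## Existence over quotients of regular local rings -/

section Existence

variable {S R : Type u} [CommRing S] [IsRegularLocalRing S] [CommRing R] [IsLocalRing R]
  [Algebra S R]

/-- **Colon-secant systems of parameters exist over quotients of regular local rings**: if
`S ↠ R` is a surjection from a regular local ring onto the local ring `R`, then every finite
`R`-module `M` of dimension `d` has a colon-secant sequence `r₁, …, r_d ∈ 𝔪_R` (a colon-secant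
system of parameters) — the colon form of the existence of CM-secant / `p`-standard systems of
parameters ([Cesnavicius2021, after Def. 3.1]; [Kawasaki2000, §2]), without any dualizing-complex
hypothesis. [cite: Cesnavicius2021, Def. 3.1 (ii); Schenzel1982, Kor. 2.4.3] -/
theorem exists_isColonSecantSequence_of_surjective (hφ : Function.Surjective (algebraMap S R))
    (M : Type u) [AddCommGroup M] [Module R M] [Module.Finite R M] {d : ℕ}
    (hd : Module.supportDim R M = d) :
    ∃ rs : List R, rs.length = d ∧ IsColonSecantSequence M rs := by
  letI : Module S M := Module.compHom M (algebraMap S R)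
  haveI : IsScalarTower S R M := ⟨fun s r m => by
    change (s • r) • m = algebraMap S R s • (r • m)
    rw [Algebra.smul_def, mul_smul]⟩
  haveI : Module.Finite S R := Module.Finite.of_surjective (Algebra.linearMap S R) hφ
  haveI : Module.Finite S M := Module.Finite.trans R M
  have hdS : Module.supportDim S M = d := by
    rw [supportDim_restrictScalars_of_surjective hφ, hd]
  obtain ⟨xs, hlen, hxs⟩ := exists_isColonSecantSequence_length_eq (S := S) (M := M) hdS
  exact ⟨xs.map (algebraMap S R), by rw [List.length_map, hlen], hxs.map_of_surjective hφ⟩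

end Existence


end Literature.AlgebraicGeometry.Resolution

end
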